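import Literature.MathematicalPhysics.QuantumLattice.ApproximateEigenvectorLemmas
import Literature.MathematicalPhysics.QuantumLattice.FermionOperatorsProofs
import HarnessLib

/-!
# Hopping amplitudes between distinct orbitals are at most one half

Topic `Literature/MathematicalPhysics/QuantumLattice` (family `hubbard`). Everything here is PROVED;
no definitions, no named facts.

For the Jordan–Wigner fermion matrices `c_p = annihilation p`, `c†_p = creation p` on the Fock space
`Fock ι = (Finset ι → ℂ)` and a UNIT vector `φ`:

* adjoint bookkeeping `⟨φ, c†_p v⟩ = ⟨c_p φ, v⟩`, `⟨φ, c_p v⟩ = ⟨c†_p φ, v⟩`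
  (`star_dotProduct_creation_mulVec`, `star_dotProduct_annihilation_mulVec`);
* `‖c_p φ‖² = ⟨n_p⟩_φ` and `‖c†_p φ‖² = 1 − ⟨n_p⟩_φ` (`eucNorm_annihilation_mulVec_sq`,
  `eucNorm_creation_mulVec_sq`; the second is the mixed CAR `c_p c†_p + c†_p c_p = 1`), whence
  `0 ≤ ⟨n_p⟩_φ ≤ 1`;
* **`|⟨φ, c†_p c_q φ⟩| ≤ 1/2` for `p ≠ q`** (`norm_star_dotProduct_creation_mul_annihilation_mulVec_le_half`):
  by Cauchy–Schwarz `|⟨φ, c†_p c_q φ⟩| = |⟨c_p φ, c_q φ⟩| ≤ √(n_p n_q)` and, anticommuting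
  (`c†_p c_q = −c_q c†_p`), `= |⟨c†_q φ, c†_p φ⟩| ≤ √((1−n_q)(1−n_p))`; the sum of the two
  arithmetic means is `1`. Equivalently `‖c†_p c_q + c†_q c_p‖ ≤ 1`: the one-body hopping between two
  modes has spectrum `{−1, 0, 1}`.

## References

* O. Bratteli, D. W. Robinson, *Operator Algebras and Quantum Statistical Mechanics 2*, §5.2.2,
  Prop. 5.2.2 (`‖a(f)‖ = ‖f‖`, CAR). [BratteliRobinsonII1997]
* F. H. L. Essler et al., *The One-Dimensional Hubbard Model* (2005), §2.1 eq. (2.2) (CAR). [EsslerEtAl2005]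
-/

noncomputable section

namespace Literature.MathematicalPhysics.QuantumLattice

open Matrix Finset

variable {ι : Type*} [LinearOrder ι] [Fintype ι]

/-- `⟨φ, c†_p v⟩ = ⟨c_p φ, v⟩` (`c†_p = c_pᴴ`). Bratteli–Robinson II §5.2.2. [folklore] -/
theorem star_dotProduct_creation_mulVec (p : ι) (φ v : Fock ι) :
    star φ ⬝ᵥ (creation p *ᵥ v) = star (annihilation p *ᵥ φ) ⬝ᵥ v := by
  rw [star_mulVec, ← dotProduct_mulVec]
  rfl

/-- `⟨φ, c_p v⟩ = ⟨c†_p φ, v⟩`. Bratteli–Robinson II §5.2.2. [folklore] -/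
theorem star_dotProduct_annihilation_mulVec (p : ι) (φ v : Fock ι) :
    star φ ⬝ᵥ (annihilation p *ᵥ v) = star (creation p *ᵥ φ) ⬝ᵥ v := by
  rw [star_mulVec, ← dotProduct_mulVec, creation, conjTranspose_conjTranspose]

/-- `‖c_p φ‖² = Re⟨φ, c†_p c_p φ⟩ = ⟨n_p⟩_φ`. Bratteli–Robinson II §5.2.2. [folklore] -/
theorem eucNorm_annihilation_mulVec_sq (p : ι) (φ : Fock ι) :
    eucNorm (annihilation p *ᵥ φ) ^ 2 = (star φ ⬝ᵥ ((creation p * annihilation p) *ᵥ φ)).re := by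
  rw [eucNorm_sq, ← mulVec_mulVec, star_dotProduct_creation_mulVec]

/-- `‖c†_p φ‖² = 1 − ⟨n_p⟩_φ` for a unit vector (mixed CAR `c_p c†_p + c†_p c_p = 1`).
Essler et al. (2005) §2.1 eq. (2.2b). [folklore] -/
theorem eucNorm_creation_mulVec_sq {φ : Fock ι} (hφ : star φ ⬝ᵥ φ = 1) (p : ι) :
    eucNorm (creation p *ᵥ φ) ^ 2 = 1 - (star φ ⬝ᵥ ((creation p * annihilation p) *ᵥ φ)).re := by
  have hcar := annihilation_mul_creation_add_creation_mul_annihilation_holds (ι := ι) p p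
  rw [if_pos rfl] at hcar
  have h1 : annihilation p * creation p = 1 - creation p * annihilation p := eq_sub_of_add_eq hcar
  rw [eucNorm_sq, ← star_dotProduct_annihilation_mulVec, mulVec_mulVec, h1, sub_mulVec, one_mulVec,
    dotProduct_sub, Complex.sub_re, hφ, Complex.one_re]

/-- `0 ≤ ⟨n_p⟩_φ`. [folklore] -/
theorem re_star_dotProduct_number_mulVec_nonneg (p : ι) (φ : Fock ι) :
    0 ≤ (star φ ⬝ᵥ ((creation p * annihilation p) *ᵥ φ)).re := by
  rw [← eucNorm_annihilation_mulVec_sq]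
  positivity

/-- `⟨n_p⟩_φ ≤ 1` for a unit vector. [folklore] -/
theorem re_star_dotProduct_number_mulVec_le_one {φ : Fock ι} (hφ : star φ ⬝ᵥ φ = 1) (p : ι) :
    (star φ ⬝ᵥ ((creation p * annihilation p) *ᵥ φ)).re ≤ 1 := by
  have h := eucNorm_creation_mulVec_sq hφ p
  nlinarith [sq_nonneg (eucNorm (creation p *ᵥ φ))]

/-- For distinct orbitals the creation and annihilation matrices anticommute:
`c†_p c_q = −c_q c†_p` (`p ≠ q`). Essler et al. (2005) §2.1 eq. (2.2b). [folklore] -/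
theorem creation_mul_annihilation_eq_neg_of_ne {p q : ι} (hpq : p ≠ q) :
    creation p * annihilation q = -(annihilation q * creation p) := by
  have hcar := annihilation_mul_creation_add_creation_mul_annihilation_holds (ι := ι) q p
  rw [if_neg (Ne.symm hpq)] at hcar
  exact eq_neg_of_add_eq_zero_right hcar

/-- **Hopping amplitudes between distinct orbitals are at most one half**: for a unit vector `φ`
and `p ≠ q`, `|⟨φ, c†_p c_q φ⟩| ≤ 1/2`. (Cauchy–Schwarz twice: `|⟨c_pφ, c_qφ⟩| ≤ ‖c_pφ‖‖c_qφ‖ ≤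
(n_p + n_q)/2` and, after anticommuting, `|⟨c†_qφ, c†_pφ⟩| ≤ (2 − n_p − n_q)/2`.) Equivalently the
two-mode hopping `c†_p c_q + c†_q c_p` has norm `≤ 1`. Bratteli–Robinson II Prop. 5.2.2. [folklore] -/
theorem norm_star_dotProduct_creation_mul_annihilation_mulVec_le_half {φ : Fock ι}
    (hφ : star φ ⬝ᵥ φ = 1) {p q : ι} (hpq : p ≠ q) :
    ‖star φ ⬝ᵥ ((creation p * annihilation q) *ᵥ φ)‖ ≤ 1 / 2 := by
  set a : ℝ := eucNorm (annihilation p *ᵥ φ) with ha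
  set b : ℝ := eucNorm (annihilation q *ᵥ φ) with hb
  set c : ℝ := eucNorm (creation p *ᵥ φ) with hc
  set d : ℝ := eucNorm (creation q *ᵥ φ) with hd
  -- Cauchy–Schwarz, particle side
  have h1 : ‖star φ ⬝ᵥ ((creation p * annihilation q) *ᵥ φ)‖ ≤ a * b := by
    rw [← mulVec_mulVec, star_dotProduct_creation_mulVec]
    exact norm_star_dotProduct_le _ _
  -- Cauchy–Schwarz, hole side (anticommute first)
  have h2 : ‖star φ ⬝ᵥ ((creation p * annihilation q) *ᵥ φ)‖ ≤ d * c := by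
    rw [creation_mul_annihilation_eq_neg_of_ne hpq, neg_mulVec, dotProduct_neg, norm_neg,
      ← mulVec_mulVec, star_dotProduct_annihilation_mulVec]
    exact norm_star_dotProduct_le _ _
  -- the four squared norms are occupation numbers
  have hasq : a ^ 2 = (star φ ⬝ᵥ ((creation p * annihilation p) *ᵥ φ)).re :=
    eucNorm_annihilation_mulVec_sq p φ
  have hbsq : b ^ 2 = (star φ ⬝ᵥ ((creation q * annihilation q) *ᵥ φ)).re :=
    eucNorm_annihilation_mulVec_sq q φ
  have hcsq : c ^ 2 = 1 - (star φ ⬝ᵥ ((creation p * annihilation p) *ᵥ φ)).re :=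
    eucNorm_creation_mulVec_sq hφ p
  have hdsq : d ^ 2 = 1 - (star φ ⬝ᵥ ((creation q * annihilation q) *ᵥ φ)).re :=
    eucNorm_creation_mulVec_sq hφ q
  -- `2ab ≤ a² + b²`, `2cd ≤ c² + d²`, and the four squares add up to `2`
  nlinarith [sq_nonneg (a - b), sq_nonneg (c - d), h1, h2, hasq, hbsq, hcsq, hdsq]

/-- Hence `|Re⟨φ, c†_p c_q φ⟩| ≤ 1/2` for a unit vector and `p ≠ q`. [folklore] -/
theorem abs_re_star_dotProduct_creation_mul_annihilation_mulVec_le_half {φ : Fock ι}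
    (hφ : star φ ⬝ᵥ φ = 1) {p q : ι} (hpq : p ≠ q) :
    |(star φ ⬝ᵥ ((creation p * annihilation q) *ᵥ φ)).re| ≤ 1 / 2 :=
  (Complex.abs_re_le_norm _).trans
    (norm_star_dotProduct_creation_mul_annihilation_mulVec_le_half hφ hpq)

end Literature.MathematicalPhysics.QuantumLattice
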